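import Mathlib
import HarnessLib

/-!
# Venture HSemireg — THEOREM M of the flat sliver: the kernel leg in full (W5 seat w5-n6-2 gen 19)

Bookkeeping of the computation cell `pub-hsemireg`, group W5 (note `widen/W5/SLIVER-w5n62g18.md`
§0–§2; this leg `widen/W5/KERNEL-M-w5n62g19.md`, deposit `widen/W5/n6code2/v22/`). The gen-18 leg
`FlatMomentWindow.lean` takes THEOREM M as a hypothesis `hM`; here THEOREM M and THEOREM M2 are
PROVED from the line sums, and COROLLARY M follows for `0 ∕ 1` data without that hypothesis.

SETTING. Four finite level types `A, B, C, D` with `t` levels each and six «torus» matrices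
`xAB : A → B → R, …, xCD : C → D → R` over a commutative ring `R`, every row and every column of
each matrix summing to `d`. With `0 ∕ 1` entries this is exactly a *flat `(d,t)` four-coordinate
design* (six `d`-regular bipartite torus graphs, N7-FEASIBILITY §3.9) and the sums below are the
transversal counts of the note: over the `t⁴` transversals `(a,b,c,e)` (one level per coordinate;
`e` is the `D`-level), `K₄` = number inducing all six tori, `P` = number inducing exactly two tori
sharing a level, `Q` = exactly five tori, `R₃` = exactly a triangle, `ΣpM` = exactly a perfect
matching, and `T_XYZ` = transversal triangles of the coordinate triple `XYZ`. Nothing in the proofs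
uses `x² = x`: the identities are multilinear, so they hold for ARBITRARY matrices with constant
line sums — the «pendant rule» of the note §1 (a coordinate met by at most one torus of a monomial
is summed out by a line sum), in the indicator basis instead of the `±1` basis.

* `momentM_monomials`, `momentM2_monomials` — pointwise: in indicator monomials the two exact-class
  combinations are `Σ2-paths − 2Σmatchings − 3Σtriangles − 3Σstars + 3Σpaws` and
  `Σ2-paths − 2Σmatchings − Σtriangles − 3Σstars + Σpaws` (35 monomials; the twelve 3-path, three
  4-cycle, six five-torus and the six-torus monomials cancel) — `ring`.
* `momentM` — **THEOREM M**: `18·K₄ + P + 4·Q = 2·ΣpM + 6 d² t (t − 2d) + 3 (3d − t)·T_tot`;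
  `momentM2` — **THEOREM M2**: `2·K₄ + P + 2·R₃ = 2·ΣpM + 6 d² t (t − 2d) + (3d − t)·T_tot`.
  Proof: one sum over transversals, the pointwise expansion, Fubini (`sum4_*`) for the twelve
  monomials whose innermost coordinate carries two tori, and the moments 2-path = matching
  = `t² d²`, star = `t d³`, triangle `XYZ` = `t·T_XYZ`, paw `XYZ + ZW` = `d·T_XYZ` (one `simp`
  with the sixteen line sums).
* `momentM_window_of_design` — **COROLLARY M without the hypothesis `hM`**: for `0 ∕ 1` matrices
  over an ordered field, line sums `d > 0`, `t > 0` levels, if the four triangle counts sum to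
  `4 t d σ` (the `|S| ≤ 3` class equations) and `K₄ − ΣpM = 2 t d σ² + t d² (t − 2d)` (the `|S| = 4`
  class equation in the form FLATTF §8 ∕ SLIVER §0), then `3 σ² − (3d − t) σ + d (t − 2d) ≤ 0`.

HONEST FRAMING: finite sums over four finite types and (ordered-)ring arithmetic only. The
identification of `0 ∕ 1` matrices with constant line sums with the cell's flat K-secant pure
coordinate skeleta, and of the two displayed laws with the `|S| ≤ 4` class equations, lives in the
notes (N7-FEASIBILITY §3.8–3.9, FLATTF-w5n62g17 §8, SLIVER-w5n62g18 §0), not here. Nothing in this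
file says that HC, HC_CM or HC_AV holds; no door ∕ tier ∕ report sentence of the cell is a
consequence of this file alone.
-/

namespace Summit.Ventures.HSemireg
namespace FlatMomentIdentity
open Finset
section Fubini
variable {α β γ δ M : Type*} [Fintype α] [Fintype β] [Fintype γ] [Fintype δ] [AddCommMonoid M]

/-- Fubini: swap the two innermost of four sums. -/
theorem sum4_swap34 (f : α → β → γ → δ → M) :
    ∑ a, ∑ b, ∑ c, ∑ e, f a b c e = ∑ a, ∑ b, ∑ e, ∑ c, f a b c e :=
  Finset.sum_congr rfl fun _ _ => Finset.sum_congr rfl fun _ _ => Finset.sum_comm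

/-- Fubini: move the second of four sums innermost. -/
theorem sum4_in2 (f : α → β → γ → δ → M) :
    ∑ a, ∑ b, ∑ c, ∑ e, f a b c e = ∑ a, ∑ c, ∑ e, ∑ b, f a b c e :=
  Finset.sum_congr rfl fun _ _ =>
    Finset.sum_comm.trans (Finset.sum_congr rfl fun _ _ => Finset.sum_comm)

/-- Fubini: move the first of four sums innermost. -/
theorem sum4_in1 (f : α → β → γ → δ → M) :
    ∑ a, ∑ b, ∑ c, ∑ e, f a b c e = ∑ b, ∑ c, ∑ e, ∑ a, f a b c e :=
  Finset.sum_comm.trans (Finset.sum_congr rfl fun _ _ =>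
    Finset.sum_comm.trans (Finset.sum_congr rfl fun _ _ => Finset.sum_comm))

/-- Fubini: move the last of four sums outermost. -/
theorem sum4_out4 (f : α → β → γ → δ → M) :
    ∑ a, ∑ b, ∑ c, ∑ e, f a b c e = ∑ e, ∑ a, ∑ b, ∑ c, f a b c e := by
  rw [sum4_in1, sum4_in1, sum4_in1]

end Fubini
section Pointwise
variable {R : Type*} [CommRing R]

/-- **THEOREM M, pointwise.** For one transversal with torus indicators `x1 … x6` (order `AB, AC,
AD, BC, BD, CD`; arbitrary ring elements) the exact-class combination `18·[K₄] + [two tori sharing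
a level] + 4·[five tori] − 2·[perfect matching]` expands in monomials as `Σ2-paths − 2Σmatchings
− 3Σtriangles − 3Σstars + 3Σpaws` (each monomial in the factor order in which `momentM` sums it). -/
theorem momentM_monomials (x1 x2 x3 x4 x5 x6 : R) :
    18 * (x1 * x2 * x3 * x4 * x5 * x6)
      + (x1 * x2 * (1 - x3) * (1 - x4) * (1 - x5) * (1 - x6)
        + x1 * x3 * (1 - x2) * (1 - x4) * (1 - x5) * (1 - x6)
        + x1 * x4 * (1 - x2) * (1 - x3) * (1 - x5) * (1 - x6)
        + x1 * x5 * (1 - x2) * (1 - x3) * (1 - x4) * (1 - x6)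
        + x2 * x3 * (1 - x1) * (1 - x4) * (1 - x5) * (1 - x6)
        + x2 * x4 * (1 - x1) * (1 - x3) * (1 - x5) * (1 - x6)
        + x2 * x6 * (1 - x1) * (1 - x3) * (1 - x4) * (1 - x5)
        + x3 * x5 * (1 - x1) * (1 - x2) * (1 - x4) * (1 - x6)
        + x3 * x6 * (1 - x1) * (1 - x2) * (1 - x4) * (1 - x5)
        + x4 * x5 * (1 - x1) * (1 - x2) * (1 - x3) * (1 - x6)
        + x4 * x6 * (1 - x1) * (1 - x2) * (1 - x3) * (1 - x5)
        + x5 * x6 * (1 - x1) * (1 - x2) * (1 - x3) * (1 - x4))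
      + 4 * (x1 * x2 * x3 * x4 * x5 * (1 - x6) + x1 * x2 * x3 * x4 * x6 * (1 - x5)
        + x1 * x2 * x3 * x5 * x6 * (1 - x4) + x1 * x2 * x4 * x5 * x6 * (1 - x3)
        + x1 * x3 * x4 * x5 * x6 * (1 - x2) + x2 * x3 * x4 * x5 * x6 * (1 - x1))
      - 2 * (x1 * x6 * (1 - x2) * (1 - x3) * (1 - x4) * (1 - x5)
        + x2 * x5 * (1 - x1) * (1 - x3) * (1 - x4) * (1 - x6)
        + x3 * x4 * (1 - x1) * (1 - x2) * (1 - x5) * (1 - x6))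
    = (x1 * x2 + x1 * x3 + x2 * x3 + x1 * x4 + x1 * x5 + x4 * x5
        + x2 * x4 + x2 * x6 + x4 * x6 + x3 * x5 + x3 * x6 + x5 * x6)
      - 2 • (x1 * x6 + x2 * x5 + x3 * x4)
      - 3 • (x1 * x2 * x4 + x1 * x3 * x5 + x2 * x3 * x6 + x4 * x5 * x6)
      - 3 • (x1 * x2 * x3 + x1 * x4 * x5 + x4 * x6 * x2 + x3 * x5 * x6)
      + 3 • (x1 * x2 * x4 * x3 + x1 * x2 * x4 * x5 + x1 * x2 * x4 * x6
        + x1 * x3 * x5 * x2 + x1 * x3 * x5 * x4 + x1 * x3 * x5 * x6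
        + x2 * x3 * x6 * x1 + x2 * x3 * x6 * x4 + x2 * x3 * x6 * x5
        + x4 * x5 * x6 * x1 + x4 * x5 * x6 * x2 + x4 * x5 * x6 * x3) := by
  simp only [nsmul_eq_mul, Nat.cast_ofNat]
  ring

/-- **THEOREM M2, pointwise.** `2·[K₄] + [two tori sharing a level] + 2·[exactly a triangle]
− 2·[perfect matching]` expands as `Σ2-paths − 2Σmatchings − Σtriangles − 3Σstars + Σpaws`. -/
theorem momentM2_monomials (x1 x2 x3 x4 x5 x6 : R) :
    2 * (x1 * x2 * x3 * x4 * x5 * x6)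
      + (x1 * x2 * (1 - x3) * (1 - x4) * (1 - x5) * (1 - x6)
        + x1 * x3 * (1 - x2) * (1 - x4) * (1 - x5) * (1 - x6)
        + x1 * x4 * (1 - x2) * (1 - x3) * (1 - x5) * (1 - x6)
        + x1 * x5 * (1 - x2) * (1 - x3) * (1 - x4) * (1 - x6)
        + x2 * x3 * (1 - x1) * (1 - x4) * (1 - x5) * (1 - x6)
        + x2 * x4 * (1 - x1) * (1 - x3) * (1 - x5) * (1 - x6)
        + x2 * x6 * (1 - x1) * (1 - x3) * (1 - x4) * (1 - x5)
        + x3 * x5 * (1 - x1) * (1 - x2) * (1 - x4) * (1 - x6)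
        + x3 * x6 * (1 - x1) * (1 - x2) * (1 - x4) * (1 - x5)
        + x4 * x5 * (1 - x1) * (1 - x2) * (1 - x3) * (1 - x6)
        + x4 * x6 * (1 - x1) * (1 - x2) * (1 - x3) * (1 - x5)
        + x5 * x6 * (1 - x1) * (1 - x2) * (1 - x3) * (1 - x4))
      + 2 * (x1 * x2 * x4 * (1 - x3) * (1 - x5) * (1 - x6)
        + x1 * x3 * x5 * (1 - x2) * (1 - x4) * (1 - x6)
        + x2 * x3 * x6 * (1 - x1) * (1 - x4) * (1 - x5)
        + x4 * x5 * x6 * (1 - x1) * (1 - x2) * (1 - x3))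
      - 2 * (x1 * x6 * (1 - x2) * (1 - x3) * (1 - x4) * (1 - x5)
        + x2 * x5 * (1 - x1) * (1 - x3) * (1 - x4) * (1 - x6)
        + x3 * x4 * (1 - x1) * (1 - x2) * (1 - x5) * (1 - x6))
    = (x1 * x2 + x1 * x3 + x2 * x3 + x1 * x4 + x1 * x5 + x4 * x5
        + x2 * x4 + x2 * x6 + x4 * x6 + x3 * x5 + x3 * x6 + x5 * x6)
      - 2 • (x1 * x6 + x2 * x5 + x3 * x4)
      - (x1 * x2 * x4 + x1 * x3 * x5 + x2 * x3 * x6 + x4 * x5 * x6)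
      - 3 • (x1 * x2 * x3 + x1 * x4 * x5 + x4 * x6 * x2 + x3 * x5 * x6)
      + (x1 * x2 * x4 * x3 + x1 * x2 * x4 * x5 + x1 * x2 * x4 * x6
        + x1 * x3 * x5 * x2 + x1 * x3 * x5 * x4 + x1 * x3 * x5 * x6
        + x2 * x3 * x6 * x1 + x2 * x3 * x6 * x4 + x2 * x3 * x6 * x5
        + x4 * x5 * x6 * x1 + x4 * x5 * x6 * x2 + x4 * x5 * x6 * x3) := by
  simp only [nsmul_eq_mul, Nat.cast_ofNat]
  ring
end Pointwise
section Design
variable {R : Type*} [CommRing R]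
variable {A B C D : Type*} [Fintype A] [Fintype B] [Fintype C] [Fintype D]
variable (t d : R) (xAB : A → B → R) (xAC : A → C → R) (xAD : A → D → R)
  (xBC : B → C → R) (xBD : B → D → R) (xCD : C → D → R)
set_option maxHeartbeats 400000 in
/-- **THEOREM M** (SLIVER-w5n62g18 §0, proved). Four finite level types with `t` levels each, six
matrices with every row and column sum `d` (`rXY` = rows, `cXY` = columns). With the sums over the
transversals `(a,b,c,e)` spelled out — `K₄` (all six tori), `P` (exactly two tori sharing a level),
`Q` (exactly five tori), `ΣpM` (exactly a perfect matching) — and the triangle counts `T_XYZ`: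
`18·K₄ + P + 4·Q = 2·ΣpM + 6 d² t (t − 2d) + 3 (3d − t)·(T_ABC + T_ABD + T_ACD + T_BCD)`.
For `0 ∕ 1` matrices these sums are the transversal counts of a flat `(d,t)` design. -/
theorem momentM (hA : (Fintype.card A : R) = t) (hB : (Fintype.card B : R) = t)
    (hC : (Fintype.card C : R) = t) (hD : (Fintype.card D : R) = t)
    (rAB : ∀ a, ∑ b, xAB a b = d) (cAB : ∀ b, ∑ a, xAB a b = d)
    (rAC : ∀ a, ∑ c, xAC a c = d) (cAC : ∀ c, ∑ a, xAC a c = d)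
    (rAD : ∀ a, ∑ e, xAD a e = d) (cAD : ∀ e, ∑ a, xAD a e = d)
    (rBC : ∀ b, ∑ c, xBC b c = d) (cBC : ∀ c, ∑ b, xBC b c = d)
    (rBD : ∀ b, ∑ e, xBD b e = d) (cBD : ∀ e, ∑ b, xBD b e = d)
    (rCD : ∀ c, ∑ e, xCD c e = d) (cCD : ∀ e, ∑ c, xCD c e = d) :
    18 * (∑ a, ∑ b, ∑ c, ∑ e, xAB a b * xAC a c * xAD a e * xBC b c * xBD b e * xCD c e)
      + (∑ a, ∑ b, ∑ c, ∑ e,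
          (xAB a b * xAC a c * (1 - xAD a e) * (1 - xBC b c) * (1 - xBD b e) * (1 - xCD c e)
          + xAB a b * xAD a e * (1 - xAC a c) * (1 - xBC b c) * (1 - xBD b e) * (1 - xCD c e)
          + xAB a b * xBC b c * (1 - xAC a c) * (1 - xAD a e) * (1 - xBD b e) * (1 - xCD c e)
          + xAB a b * xBD b e * (1 - xAC a c) * (1 - xAD a e) * (1 - xBC b c) * (1 - xCD c e)
          + xAC a c * xAD a e * (1 - xAB a b) * (1 - xBC b c) * (1 - xBD b e) * (1 - xCD c e)
          + xAC a c * xBC b c * (1 - xAB a b) * (1 - xAD a e) * (1 - xBD b e) * (1 - xCD c e)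
          + xAC a c * xCD c e * (1 - xAB a b) * (1 - xAD a e) * (1 - xBC b c) * (1 - xBD b e)
          + xAD a e * xBD b e * (1 - xAB a b) * (1 - xAC a c) * (1 - xBC b c) * (1 - xCD c e)
          + xAD a e * xCD c e * (1 - xAB a b) * (1 - xAC a c) * (1 - xBC b c) * (1 - xBD b e)
          + xBC b c * xBD b e * (1 - xAB a b) * (1 - xAC a c) * (1 - xAD a e) * (1 - xCD c e)
          + xBC b c * xCD c e * (1 - xAB a b) * (1 - xAC a c) * (1 - xAD a e) * (1 - xBD b e)
          + xBD b e * xCD c e * (1 - xAB a b) * (1 - xAC a c) * (1 - xAD a e) * (1 - xBC b c)))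
      + 4 * (∑ a, ∑ b, ∑ c, ∑ e,
          (xAB a b * xAC a c * xAD a e * xBC b c * xBD b e * (1 - xCD c e)
          + xAB a b * xAC a c * xAD a e * xBC b c * xCD c e * (1 - xBD b e)
          + xAB a b * xAC a c * xAD a e * xBD b e * xCD c e * (1 - xBC b c)
          + xAB a b * xAC a c * xBC b c * xBD b e * xCD c e * (1 - xAD a e)
          + xAB a b * xAD a e * xBC b c * xBD b e * xCD c e * (1 - xAC a c)
          + xAC a c * xAD a e * xBC b c * xBD b e * xCD c e * (1 - xAB a b)))
    = 2 * (∑ a, ∑ b, ∑ c, ∑ e,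
          (xAB a b * xCD c e * (1 - xAC a c) * (1 - xAD a e) * (1 - xBC b c) * (1 - xBD b e)
          + xAC a c * xBD b e * (1 - xAB a b) * (1 - xAD a e) * (1 - xBC b c) * (1 - xCD c e)
          + xAD a e * xBC b c * (1 - xAB a b) * (1 - xAC a c) * (1 - xBD b e) * (1 - xCD c e)))
      + 6 * d ^ 2 * t * (t - 2 * d)
      + 3 * (3 * d - t) * ((∑ a, ∑ b, ∑ c, xAB a b * xAC a c * xBC b c)
          + (∑ a, ∑ b, ∑ e, xAB a b * xAD a e * xBD b e)
          + (∑ a, ∑ c, ∑ e, xAC a c * xAD a e * xCD c e)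
          + (∑ b, ∑ c, ∑ e, xBC b c * xBD b e * xCD c e)) := by
  -- the combination as ONE sum over transversals: expand pointwise, split, Fubini, line sums
  have hsum : ∑ a, ∑ b, ∑ c, ∑ e,
      (18 * (xAB a b * xAC a c * xAD a e * xBC b c * xBD b e * xCD c e)
      + (xAB a b * xAC a c * (1 - xAD a e) * (1 - xBC b c) * (1 - xBD b e) * (1 - xCD c e)
          + xAB a b * xAD a e * (1 - xAC a c) * (1 - xBC b c) * (1 - xBD b e) * (1 - xCD c e)
          + xAB a b * xBC b c * (1 - xAC a c) * (1 - xAD a e) * (1 - xBD b e) * (1 - xCD c e)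
          + xAB a b * xBD b e * (1 - xAC a c) * (1 - xAD a e) * (1 - xBC b c) * (1 - xCD c e)
          + xAC a c * xAD a e * (1 - xAB a b) * (1 - xBC b c) * (1 - xBD b e) * (1 - xCD c e)
          + xAC a c * xBC b c * (1 - xAB a b) * (1 - xAD a e) * (1 - xBD b e) * (1 - xCD c e)
          + xAC a c * xCD c e * (1 - xAB a b) * (1 - xAD a e) * (1 - xBC b c) * (1 - xBD b e)
          + xAD a e * xBD b e * (1 - xAB a b) * (1 - xAC a c) * (1 - xBC b c) * (1 - xCD c e)
          + xAD a e * xCD c e * (1 - xAB a b) * (1 - xAC a c) * (1 - xBC b c) * (1 - xBD b e)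
          + xBC b c * xBD b e * (1 - xAB a b) * (1 - xAC a c) * (1 - xAD a e) * (1 - xCD c e)
          + xBC b c * xCD c e * (1 - xAB a b) * (1 - xAC a c) * (1 - xAD a e) * (1 - xBD b e)
          + xBD b e * xCD c e * (1 - xAB a b) * (1 - xAC a c) * (1 - xAD a e) * (1 - xBC b c))
      + 4 * (xAB a b * xAC a c * xAD a e * xBC b c * xBD b e * (1 - xCD c e)
          + xAB a b * xAC a c * xAD a e * xBC b c * xCD c e * (1 - xBD b e)
          + xAB a b * xAC a c * xAD a e * xBD b e * xCD c e * (1 - xBC b c)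
          + xAB a b * xAC a c * xBC b c * xBD b e * xCD c e * (1 - xAD a e)
          + xAB a b * xAD a e * xBC b c * xBD b e * xCD c e * (1 - xAC a c)
          + xAC a c * xAD a e * xBC b c * xBD b e * xCD c e * (1 - xAB a b))
      - 2 * (xAB a b * xCD c e * (1 - xAC a c) * (1 - xAD a e) * (1 - xBC b c) * (1 - xBD b e)
          + xAC a c * xBD b e * (1 - xAB a b) * (1 - xAD a e) * (1 - xBC b c) * (1 - xCD c e)
          + xAD a e * xBC b c * (1 - xAB a b) * (1 - xAC a c) * (1 - xBD b e) * (1 - xCD c e)))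
      = 6 * d ^ 2 * t * (t - 2 * d)
        + 3 * (3 * d - t) * ((∑ a, ∑ b, ∑ c, xAB a b * xAC a c * xBC b c)
          + (∑ a, ∑ b, ∑ e, xAB a b * xAD a e * xBD b e)
          + (∑ a, ∑ c, ∑ e, xAC a c * xAD a e * xCD c e)
          + (∑ b, ∑ c, ∑ e, xBC b c * xBD b e * xCD c e)) := by
    simp_rw [momentM_monomials]
    simp only [sum_add_distrib, sum_sub_distrib, ← smul_sum]
    -- Fubini for the twelve monomials whose innermost coordinate carries two tori
    rw [sum4_in2 fun a b c _ => xAC a c * xBC b c, sum4_in2 fun a b _ e => xAD a e * xBD b e,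
      sum4_swap34 fun a _ c e => xAD a e * xCD c e, sum4_swap34 fun _ b c e => xBD b e * xCD c e,
      sum4_in1 fun a b c e => xBC b c * xCD c e * xAC a c,
      sum4_out4 fun a b c e => xAD a e * xBD b e * xCD c e,
      sum4_swap34 fun a b c e => xAB a b * xAD a e * xBD b e * xCD c e,
      sum4_in2 fun a b c e => xAC a c * xAD a e * xCD c e * xBC b c,
      sum4_in2 fun a b c e => xAC a c * xAD a e * xCD c e * xBD b e,
      sum4_in1 fun a b c e => xBC b c * xBD b e * xCD c e * xAB a b,
      sum4_in1 fun a b c e => xBC b c * xBD b e * xCD c e * xAC a c,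
      sum4_in1 fun a b c e => xBC b c * xBD b e * xCD c e * xAD a e]
    simp only [sum_const, card_univ, nsmul_eq_mul, hA, hB, hC, hD, ← mul_sum, ← sum_mul,
      rAB, cAB, rAC, cAC, rAD, cAD, rBC, cBC, rBD, cBD, rCD, cCD, Nat.cast_ofNat]
    ring
  simp only [sum_add_distrib, sum_sub_distrib, ← mul_sum] at hsum ⊢
  linear_combination hsum

/-- **THEOREM M2** (SLIVER-w5n62g18 §0, proved; same data as `momentM`). With `R₃` = number of
transversals inducing exactly a triangle (fourth level isolated):
`2·K₄ + P + 2·R₃ = 2·ΣpM + 6 d² t (t − 2d) + (3d − t)·(T_ABC + T_ABD + T_ACD + T_BCD)`. -/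
theorem momentM2 (hA : (Fintype.card A : R) = t) (hB : (Fintype.card B : R) = t)
    (hC : (Fintype.card C : R) = t) (hD : (Fintype.card D : R) = t)
    (rAB : ∀ a, ∑ b, xAB a b = d) (cAB : ∀ b, ∑ a, xAB a b = d)
    (rAC : ∀ a, ∑ c, xAC a c = d) (cAC : ∀ c, ∑ a, xAC a c = d)
    (rAD : ∀ a, ∑ e, xAD a e = d) (cAD : ∀ e, ∑ a, xAD a e = d)
    (rBC : ∀ b, ∑ c, xBC b c = d) (cBC : ∀ c, ∑ b, xBC b c = d)
    (rBD : ∀ b, ∑ e, xBD b e = d) (cBD : ∀ e, ∑ b, xBD b e = d)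
    (rCD : ∀ c, ∑ e, xCD c e = d) (cCD : ∀ e, ∑ c, xCD c e = d) :
    2 * (∑ a, ∑ b, ∑ c, ∑ e, xAB a b * xAC a c * xAD a e * xBC b c * xBD b e * xCD c e)
      + (∑ a, ∑ b, ∑ c, ∑ e,
          (xAB a b * xAC a c * (1 - xAD a e) * (1 - xBC b c) * (1 - xBD b e) * (1 - xCD c e)
          + xAB a b * xAD a e * (1 - xAC a c) * (1 - xBC b c) * (1 - xBD b e) * (1 - xCD c e)
          + xAB a b * xBC b c * (1 - xAC a c) * (1 - xAD a e) * (1 - xBD b e) * (1 - xCD c e)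
          + xAB a b * xBD b e * (1 - xAC a c) * (1 - xAD a e) * (1 - xBC b c) * (1 - xCD c e)
          + xAC a c * xAD a e * (1 - xAB a b) * (1 - xBC b c) * (1 - xBD b e) * (1 - xCD c e)
          + xAC a c * xBC b c * (1 - xAB a b) * (1 - xAD a e) * (1 - xBD b e) * (1 - xCD c e)
          + xAC a c * xCD c e * (1 - xAB a b) * (1 - xAD a e) * (1 - xBC b c) * (1 - xBD b e)
          + xAD a e * xBD b e * (1 - xAB a b) * (1 - xAC a c) * (1 - xBC b c) * (1 - xCD c e)
          + xAD a e * xCD c e * (1 - xAB a b) * (1 - xAC a c) * (1 - xBC b c) * (1 - xBD b e)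
          + xBC b c * xBD b e * (1 - xAB a b) * (1 - xAC a c) * (1 - xAD a e) * (1 - xCD c e)
          + xBC b c * xCD c e * (1 - xAB a b) * (1 - xAC a c) * (1 - xAD a e) * (1 - xBD b e)
          + xBD b e * xCD c e * (1 - xAB a b) * (1 - xAC a c) * (1 - xAD a e) * (1 - xBC b c)))
      + 2 * (∑ a, ∑ b, ∑ c, ∑ e,
          (xAB a b * xAC a c * xBC b c * (1 - xAD a e) * (1 - xBD b e) * (1 - xCD c e)
          + xAB a b * xAD a e * xBD b e * (1 - xAC a c) * (1 - xBC b c) * (1 - xCD c e)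
          + xAC a c * xAD a e * xCD c e * (1 - xAB a b) * (1 - xBC b c) * (1 - xBD b e)
          + xBC b c * xBD b e * xCD c e * (1 - xAB a b) * (1 - xAC a c) * (1 - xAD a e)))
    = 2 * (∑ a, ∑ b, ∑ c, ∑ e,
          (xAB a b * xCD c e * (1 - xAC a c) * (1 - xAD a e) * (1 - xBC b c) * (1 - xBD b e)
          + xAC a c * xBD b e * (1 - xAB a b) * (1 - xAD a e) * (1 - xBC b c) * (1 - xCD c e)
          + xAD a e * xBC b c * (1 - xAB a b) * (1 - xAC a c) * (1 - xBD b e) * (1 - xCD c e)))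
      + 6 * d ^ 2 * t * (t - 2 * d)
      + (3 * d - t) * ((∑ a, ∑ b, ∑ c, xAB a b * xAC a c * xBC b c)
          + (∑ a, ∑ b, ∑ e, xAB a b * xAD a e * xBD b e)
          + (∑ a, ∑ c, ∑ e, xAC a c * xAD a e * xCD c e)
          + (∑ b, ∑ c, ∑ e, xBC b c * xBD b e * xCD c e)) := by
  have hsum : ∑ a, ∑ b, ∑ c, ∑ e,
      (2 * (xAB a b * xAC a c * xAD a e * xBC b c * xBD b e * xCD c e)
      + (xAB a b * xAC a c * (1 - xAD a e) * (1 - xBC b c) * (1 - xBD b e) * (1 - xCD c e)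
          + xAB a b * xAD a e * (1 - xAC a c) * (1 - xBC b c) * (1 - xBD b e) * (1 - xCD c e)
          + xAB a b * xBC b c * (1 - xAC a c) * (1 - xAD a e) * (1 - xBD b e) * (1 - xCD c e)
          + xAB a b * xBD b e * (1 - xAC a c) * (1 - xAD a e) * (1 - xBC b c) * (1 - xCD c e)
          + xAC a c * xAD a e * (1 - xAB a b) * (1 - xBC b c) * (1 - xBD b e) * (1 - xCD c e)
          + xAC a c * xBC b c * (1 - xAB a b) * (1 - xAD a e) * (1 - xBD b e) * (1 - xCD c e)
          + xAC a c * xCD c e * (1 - xAB a b) * (1 - xAD a e) * (1 - xBC b c) * (1 - xBD b e)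
          + xAD a e * xBD b e * (1 - xAB a b) * (1 - xAC a c) * (1 - xBC b c) * (1 - xCD c e)
          + xAD a e * xCD c e * (1 - xAB a b) * (1 - xAC a c) * (1 - xBC b c) * (1 - xBD b e)
          + xBC b c * xBD b e * (1 - xAB a b) * (1 - xAC a c) * (1 - xAD a e) * (1 - xCD c e)
          + xBC b c * xCD c e * (1 - xAB a b) * (1 - xAC a c) * (1 - xAD a e) * (1 - xBD b e)
          + xBD b e * xCD c e * (1 - xAB a b) * (1 - xAC a c) * (1 - xAD a e) * (1 - xBC b c))
      + 2 * (xAB a b * xAC a c * xBC b c * (1 - xAD a e) * (1 - xBD b e) * (1 - xCD c e)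
          + xAB a b * xAD a e * xBD b e * (1 - xAC a c) * (1 - xBC b c) * (1 - xCD c e)
          + xAC a c * xAD a e * xCD c e * (1 - xAB a b) * (1 - xBC b c) * (1 - xBD b e)
          + xBC b c * xBD b e * xCD c e * (1 - xAB a b) * (1 - xAC a c) * (1 - xAD a e))
      - 2 * (xAB a b * xCD c e * (1 - xAC a c) * (1 - xAD a e) * (1 - xBC b c) * (1 - xBD b e)
          + xAC a c * xBD b e * (1 - xAB a b) * (1 - xAD a e) * (1 - xBC b c) * (1 - xCD c e)
          + xAD a e * xBC b c * (1 - xAB a b) * (1 - xAC a c) * (1 - xBD b e) * (1 - xCD c e)))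
      = 6 * d ^ 2 * t * (t - 2 * d)
        + (3 * d - t) * ((∑ a, ∑ b, ∑ c, xAB a b * xAC a c * xBC b c)
          + (∑ a, ∑ b, ∑ e, xAB a b * xAD a e * xBD b e)
          + (∑ a, ∑ c, ∑ e, xAC a c * xAD a e * xCD c e)
          + (∑ b, ∑ c, ∑ e, xBC b c * xBD b e * xCD c e)) := by
    simp_rw [momentM2_monomials]
    simp only [sum_add_distrib, sum_sub_distrib, ← smul_sum]
    rw [sum4_in2 fun a b c _ => xAC a c * xBC b c, sum4_in2 fun a b _ e => xAD a e * xBD b e,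
      sum4_swap34 fun a _ c e => xAD a e * xCD c e, sum4_swap34 fun _ b c e => xBD b e * xCD c e,
      sum4_in1 fun a b c e => xBC b c * xCD c e * xAC a c,
      sum4_out4 fun a b c e => xAD a e * xBD b e * xCD c e,
      sum4_swap34 fun a b c e => xAB a b * xAD a e * xBD b e * xCD c e,
      sum4_in2 fun a b c e => xAC a c * xAD a e * xCD c e * xBC b c,
      sum4_in2 fun a b c e => xAC a c * xAD a e * xCD c e * xBD b e,
      sum4_in1 fun a b c e => xBC b c * xBD b e * xCD c e * xAB a b,
      sum4_in1 fun a b c e => xBC b c * xBD b e * xCD c e * xAC a c,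
      sum4_in1 fun a b c e => xBC b c * xBD b e * xCD c e * xAD a e]
    simp only [sum_const, card_univ, nsmul_eq_mul, hA, hB, hC, hD, ← mul_sum, ← sum_mul,
      rAB, cAB, rAC, cAC, rAD, cAD, rBC, cBC, rBD, cBD, rCD, cCD, Nat.cast_ofNat]
    ring
  simp only [sum_add_distrib, sum_sub_distrib, ← mul_sum] at hsum ⊢
  linear_combination hsum
end Design
section Window
variable {F : Type*} [Field F] [LinearOrder F] [IsStrictOrderedRing F]
variable {A B C D : Type*} [Fintype A] [Fintype B] [Fintype C] [Fintype D]

/-- a `0 ∕ 1` value is non-negative -/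
theorem nonneg_of_zero_or_one {x : F} (h : x = 0 ∨ x = 1) : 0 ≤ x := by
  rcases h with rfl | rfl <;> norm_num

/-- one minus a `0 ∕ 1` value is non-negative -/
theorem one_sub_nonneg_of_zero_or_one {x : F} (h : x = 0 ∨ x = 1) : 0 ≤ 1 - x := by
  rcases h with rfl | rfl <;> norm_num

/-- **COROLLARY M, unconditional in THEOREM M** (the window of the dense flat sliver). Six `0 ∕ 1`
matrices over an ordered field between four level types with `t > 0` levels each, all row and
column sums `d > 0` (a flat `(d,t)` four-coordinate design). If the four transversal triangle
counts sum to `4 t d σ` and `K₄ − ΣpM = 2 t d σ² + t d² (t − 2d)` (the `|S| ≤ 3` and `|S| = 4`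
class equations of a `K`-secant skeleton in the form FLATTF §8 ∕ SLIVER §0), then
`3 σ² − (3d − t) σ + d (t − 2d) ≤ 0`. Proof: `momentM` gives
`P + 4Q + 16·ΣpM = 12 t d ((3d − t) σ − 3σ² − d (t − 2d))` with `P, Q, ΣpM ≥ 0`. -/
theorem momentM_window_of_design (t d σ : F) (xAB : A → B → F) (xAC : A → C → F)
    (xAD : A → D → F) (xBC : B → C → F) (xBD : B → D → F) (xCD : C → D → F)
    (ht : 0 < t) (hd : 0 < d)
    (hA : (Fintype.card A : F) = t) (hB : (Fintype.card B : F) = t)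
    (hC : (Fintype.card C : F) = t) (hD : (Fintype.card D : F) = t)
    (zAB : ∀ a b, xAB a b = 0 ∨ xAB a b = 1) (zAC : ∀ a c, xAC a c = 0 ∨ xAC a c = 1)
    (zAD : ∀ a e, xAD a e = 0 ∨ xAD a e = 1) (zBC : ∀ b c, xBC b c = 0 ∨ xBC b c = 1)
    (zBD : ∀ b e, xBD b e = 0 ∨ xBD b e = 1) (zCD : ∀ c e, xCD c e = 0 ∨ xCD c e = 1)
    (rAB : ∀ a, ∑ b, xAB a b = d) (cAB : ∀ b, ∑ a, xAB a b = d)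
    (rAC : ∀ a, ∑ c, xAC a c = d) (cAC : ∀ c, ∑ a, xAC a c = d)
    (rAD : ∀ a, ∑ e, xAD a e = d) (cAD : ∀ e, ∑ a, xAD a e = d)
    (rBC : ∀ b, ∑ c, xBC b c = d) (cBC : ∀ c, ∑ b, xBC b c = d)
    (rBD : ∀ b, ∑ e, xBD b e = d) (cBD : ∀ e, ∑ b, xBD b e = d)
    (rCD : ∀ c, ∑ e, xCD c e = d) (cCD : ∀ e, ∑ c, xCD c e = d)
    (hT : (∑ a, ∑ b, ∑ c, xAB a b * xAC a c * xBC b c)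
          + (∑ a, ∑ b, ∑ e, xAB a b * xAD a e * xBD b e)
          + (∑ a, ∑ c, ∑ e, xAC a c * xAD a e * xCD c e)
          + (∑ b, ∑ c, ∑ e, xBC b c * xBD b e * xCD c e) = 4 * t * d * σ)
    (hlaw : (∑ a, ∑ b, ∑ c, ∑ e, xAB a b * xAC a c * xAD a e * xBC b c * xBD b e * xCD c e)
        - (∑ a, ∑ b, ∑ c, ∑ e,
          (xAB a b * xCD c e * (1 - xAC a c) * (1 - xAD a e) * (1 - xBC b c) * (1 - xBD b e)
          + xAC a c * xBD b e * (1 - xAB a b) * (1 - xAD a e) * (1 - xBC b c) * (1 - xCD c e)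
          + xAD a e * xBC b c * (1 - xAB a b) * (1 - xAC a c) * (1 - xBD b e) * (1 - xCD c e)))
        = 2 * t * d * σ ^ 2 + t * d ^ 2 * (t - 2 * d)) :
    3 * σ ^ 2 - (3 * d - t) * σ + d * (t - 2 * d) ≤ 0 := by
  -- THEOREM M for this design, with the class sums abstracted, and the signs of `P, Q, ΣpM`
  obtain ⟨K, P, Q, M, T, hM, hT', hlaw', hP, hQ, hMnn⟩ : ∃ K P Q M T : F,
      18 * K + P + 4 * Q = 2 * M + 6 * d ^ 2 * t * (t - 2 * d) + 3 * (3 * d - t) * T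
      ∧ T = 4 * t * d * σ ∧ K - M = 2 * t * d * σ ^ 2 + t * d ^ 2 * (t - 2 * d)
      ∧ 0 ≤ P ∧ 0 ≤ Q ∧ 0 ≤ M := by
    refine ⟨_, _, _, _, _, momentM t d xAB xAC xAD xBC xBD xCD hA hB hC hD rAB cAB rAC cAC
      rAD cAD rBC cBC rBD cBD rCD cCD, hT, hlaw, ?_, ?_, ?_⟩
    all_goals
      refine sum_nonneg fun a _ => sum_nonneg fun b _ => sum_nonneg fun c _ =>
        sum_nonneg fun e _ => ?_
      have h1 := zAB a b; have h2 := zAC a c; have h3 := zAD a e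
      have h4 := zBC b c; have h5 := zBD b e; have h6 := zCD c e
      repeat (first
        | refine add_nonneg ?_ ?_
        | refine mul_nonneg ?_ ?_
        | exact one_sub_nonneg_of_zero_or_one ‹_›
        | exact nonneg_of_zero_or_one ‹_›)
  have hs : P + 4 * Q + 16 * M = 12 * t * d * ((3 * d - t) * σ - 3 * σ ^ 2 - d * (t - 2 * d)) := by
    linear_combination hM - 18 * hlaw' + 3 * (3 * d - t) * hT'
  have htd : 0 < 12 * t * d := by positivity
  nlinarith [hs, hP, hQ, hMnn, htd]
end Window
end FlatMomentIdentity
end Summit.Ventures.HSemireg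

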